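import Summits.BirchSwinnertonDyer.Rank1Residual.X12.O11.RouteUPrimeMember
import Summits.BirchSwinnertonDyer.Rank1Residual.X12.O11.RouteUBernoulliD11
import HarnessLib

/-!
# ROUTE U, member `D = −11` (`5929e1 = 49a1^{(−11)}`, Heegner field `ℚ(√−19)`) THROUGH THE
# PRIME-MEMBER CLASS THEOREM: BSD₇ and FULL BSD with the descent inputs discharged

bsd-cm cell (run/shared/lean/pub/bsd-cm/), ROUTE U, seat `bsd-cm-ram`. The member theorems
`RouteU.bsdp_seven_of_twist_cm7_D11` / `…_D11'` of `RouteUSeven5929` display the descent binders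
`hSel : #Sel₇(W) ∣ 7` and `hiv` (no `7`-torsion over `K`). This file re-derives the member from the
class theorem `RouteU.bsdp_seven_of_twist_cm7_prime` at `(q, r) = (11, 19)`, in which BOTH are
discharged (`hiv`: Mazur's local step at the additive `7`, `RouteUDescentLocal`; `7 ∤ #Ш(W)`:
Buhler–Gross 1985 Ch. II BY NAME, binder `hBG`), and adds the FULL-BSD corollary on `𝒞₇`.
The two Bernoulli certificates are those of `RouteUBernoulliD11` (`θ₁` mod `77`, `θ₂` mod `1463`),
read in the class theorem's shape (`7·11 = 77`, `7·11·19 = 1463` definitionally; `J(j | 19) = (j/19)`).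
THEOREMS ONLY; nothing booked; the remaining displayed inputs are named published facts
(Kriz–Li Thm 1.20 / Rem 3.10, Gross–Zagier, Kolyvagin, GZK, modularity, Rubin 1983 Thm C,
Burungale–Flach 2024, Buhler–Gross 1985; for full BSD also Li–Liu–Tian 2024, Kobayashi 2013,
Li–Tian–Yan–Zhu 2025), `r_an(W) = 1` (resp. `W ∈ 𝒞₇`), the Heegner datum, a Mordell–Weil coordinate
over `K`, `L(W^{(−19)}, 1) ≠ 0`, the twin's minimal-model data and `7 ∤ c` (Manin constant).
References: [KrizLi2019] Thm 1.20, Rem 3.10; [Rubin1983] Thm C; [BuhlerGross1985] Ch. II;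
[BurungaleFlach2024] Thm 1.1; [Miller2011LMS] Def. 1.1.
-/

noncomputable section

open scoped Classical
open NumberField WeierstrassCurve DirichletCharacter
open Literature.NumberTheory.EllipticCurves Literature.NumberTheory.EllipticCurves.Rank1Residual
open Literature.NumberTheory.EllipticCurves.KrizLi2019 Literature.NumberTheory.LFunctions
open Literature.NumberTheory.EllipticCurves.ModularForms

namespace Summit.BirchSwinnertonDyer.Rank1Residual.X12.O11.RouteU

set_option maxRecDepth 20000 in
/-- The `θ₁`-certificate of `RouteUBernoulliD11` (level `77`) in the class theorem's shape (level
`7·11`). [cite: KrizLi2019, Thm. 1.20 (p. 8) and §1.5 (1)] -/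
theorem cert_theta1_D11 : ∀ (ω : DirichletCharacter ℚ_[7] 7), IsTeichmullerCharacter ω →
    ∀ θ : DirichletCharacter ℚ_[7] (7 * 11),
      (∀ j : ZMod (7 * 11), θ j = (legendreSym 11 (j.val : ℤ) : ℚ_[7]) * ω (j.val : ZMod 7) ^ 4) →
      ‖generalizedBernoulli 1 θ‖ = 1 :=
  fun ω hω θ hθ => norm_generalizedBernoulli_theta1_D11 ω hω θ hθ

set_option maxRecDepth 20000 in
/-- The `θ₂`-certificate of `RouteUBernoulliD11` (level `77·19`, values `(j/11)(j/19)ω(j)`) in the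
class theorem's shape (level `7·11·19`, values `(j/11)·J(j|19)·ω(j)`). [cite: KrizLi2019, Thm. 1.20 (p. 8) and §1.5 (1)] -/
theorem cert_theta2_D11 : ∀ (ω : DirichletCharacter ℚ_[7] 7), IsTeichmullerCharacter ω →
    ∀ θ : DirichletCharacter ℚ_[7] (7 * 11 * 19),
      (∀ j : ZMod (7 * 11 * 19), θ j =
        ((legendreSym 11 (j.val : ℤ) * jacobiSym (j.val : ℤ) 19 : ℤ) : ℚ_[7]) * ω (j.val : ZMod 7) ^ 1) →
      ‖generalizedBernoulli 1 θ‖ = 1 :=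
  fun ω hω θ hθ => norm_generalizedBernoulli_theta2_D11 ω hω θ fun j => by
    have h := hθ j
    rw [← jacobiSym.legendreSym.to_jacobiSym] at h
    exact h

/-- **ROUTE U, member `D = −11` (`5929e1`, `N = 5929`): BSD₇ for every globally minimal model of `49a1^{(−11)}`
with `r_an = 1`**, by the prime-member class theorem at `(q, r) = (11, 19)` with the two
certificates above; the descent inputs (no `7`-torsion over `K`, `7 ∤ #Ш(W)`) are discharged inside the
class theorem (Mazur's local step; Buhler–Gross 1985 Ch. II BY NAME, binder `hBG`). [cite: KrizLi2019, Thm. 1.20 and Rem. 3.10] [cite: Rubin1983, §0 Thm. C (p. 341)]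
[cite: BurungaleFlach2024, Thm 1.1 and Cor. 2] [cite: GrossZagier1986, I.(6.5) and V.(2.1)]
[cite: Miller2011LMS, Thm. 2.5 and (5.1)] [cite: BuhlerGross1985, Ch. II (7.2)(2), (8.3)(1), (9.1) (pp. 16–18)] -/
theorem bsdp_seven_of_twist_cm7_D11_byClass
    (hKL : KrizLi2019.thm120_padicLogHeegner_unit_of_bernoulli)
    (hRem : KrizLi2019.rem310_padicLogHeegner_integral)
    (W : WeierstrassCurve ℚ) [W.IsElliptic] [W.IsGloballyMinimal] [NeZero (W.conductorNorm ℤ)]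
    (hW : ∃ C : VariableChange ℚ, C • W = cm7.quadraticTwist ((-(11 : ℕ) : ℤ) : ℚ))
    (K : Type) [Field K] [NumberField K] [NeZero (NumberField.discr K).natAbs]
    (hK : IsImaginaryQuadratic K) (hdK : NumberField.discr K = -(19 : ℕ))
    (D : ModularParametrizationData W (W.conductorNorm ℤ))
    (H : HeegnerDatum (W.conductorNorm ℤ) (NumberField.discr K)) (ι : K →+* ℂ) (ιp : K →+* ℚ_[7])
    (P : (W.baseChange K).toAffine.Point)
    (hGZ : gross_zagier (W.conductorNorm ℤ) W K) (hKo : kolyvagin (W.conductorNorm ℤ) W K)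
    (hGZK : rank_eq_analyticRank_of_analyticRank_le_one) (hmod : hasEntireLFunction_rat)
    (hP : WeierstrassCurve.Affine.Point.map ι.toRatAlgHom P = heegnerPointComplex D H)
    (hr1 : W.analyticRank = 1)
    (hLt : (W.quadraticTwist (NumberField.discr K : ℚ)).entireLFunction 1 ≠ 0)
    (Wd : WeierstrassCurve ℚ) [Wd.IsElliptic] [Wd.IsGloballyMinimal] (Cd : VariableChange ℚ)
    (hWd : Cd • W.quadraticTwist (NumberField.discr K : ℚ) = Wd)
    (hBF : bsdTriple_of_hasCM_of_L_one_ne_zero)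
    (hu : padicValRat 7 (Cd.u : ℚ) = 0)
    (hC : Rubin1983.thmC_seven_quadraticField)
    (hBG : BuhlerGross1985.firstDescent_seven_oddTwist_of_bernoulli)
    [Finite (AddCommGroup.torsion (W.baseChange K).toAffine.Point)]
    (crd : (W.baseChange K).toAffine.Point →+ ℤ) (g : (W.baseChange K).toAffine.Point)
    (hg : crd g = 1) (hker : ∀ x, crd x = 0 → IsOfFinAddOrder x)
    (hc7 : ¬ ((7 : ℤ) ∣ D.c)) :
    BSDp W 7 :=
  bsdp_seven_of_twist_cm7_prime (q := 11) (r := 19) (by norm_num) (by norm_num) (by norm_num)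
    (by norm_num) (by norm_num) (by norm_num)
    (by rw [legendreSym_eq_ite 7 (by norm_num)]; decide)
    (by rw [legendreSym_eq_ite 11 (by norm_num)]; decide)
    (cert_theta1_D11) (cert_theta2_D11)
    hKL hRem W hW K hK hdK D H ι ιp P hGZ hKo hGZK hmod hP hr1 hLt Wd Cd hWd hBF hu hC hBG crd g hg
    hker hc7

/-- **ROUTE U, member `D = −11` (`5929e1`): FULL BSD** (Miller's `BSD(E,p)` at EVERY prime) for every globally
minimal model of `49a1^{(−11)}` with `r_an = 1` (`W ∈ 𝒞₇` since `(−7/11) = 1`), by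
`forall_bsdp_of_twist_cm7_prime` at `(q, r) = (11, 19)`.
[cite: Miller2011LMS, §1 and Def. 1.1 (arXiv:1010.2431 p. 3)] [cite: KrizLi2019, Thm. 1.20 and Rem. 3.10] -/
theorem forall_bsdp_of_twist_cm7_D11
    (hKL : KrizLi2019.thm120_padicLogHeegner_unit_of_bernoulli)
    (hRem : KrizLi2019.rem310_padicLogHeegner_integral)
    (W : WeierstrassCurve ℚ) [W.IsElliptic] [W.IsGloballyMinimal] [NeZero (W.conductorNorm ℤ)]
    (hW : ∃ C : VariableChange ℚ, C • W = cm7.quadraticTwist ((-(11 : ℕ) : ℤ) : ℚ))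
    (K : Type) [Field K] [NumberField K] [NeZero (NumberField.discr K).natAbs]
    (hK : IsImaginaryQuadratic K) (hdK : NumberField.discr K = -(19 : ℕ))
    (D : ModularParametrizationData W (W.conductorNorm ℤ))
    (H : HeegnerDatum (W.conductorNorm ℤ) (NumberField.discr K)) (ι : K →+* ℂ) (ιp : K →+* ℚ_[7])
    (P : (W.baseChange K).toAffine.Point)
    (hGZ : gross_zagier (W.conductorNorm ℤ) W K) (hKo : kolyvagin (W.conductorNorm ℤ) W K)
    (hGZK : rank_eq_analyticRank_of_analyticRank_le_one) (hmod : hasEntireLFunction_rat)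
    (hP : WeierstrassCurve.Affine.Point.map ι.toRatAlgHom P = heegnerPointComplex D H)
    (hr1 : W.analyticRank = 1)
    (hLt : (W.quadraticTwist (NumberField.discr K : ℚ)).entireLFunction 1 ≠ 0)
    (Wd : WeierstrassCurve ℚ) [Wd.IsElliptic] [Wd.IsGloballyMinimal] (Cd : VariableChange ℚ)
    (hWd : Cd • W.quadraticTwist (NumberField.discr K : ℚ) = Wd)
    (hBF : bsdTriple_of_hasCM_of_L_one_ne_zero)
    (hu : padicValRat 7 (Cd.u : ℚ) = 0)
    (hC : Rubin1983.thmC_seven_quadraticField)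
    (hBG : BuhlerGross1985.firstDescent_seven_oddTwist_of_bernoulli)
    [Finite (AddCommGroup.torsion (W.baseChange K).toAffine.Point)]
    (crd : (W.baseChange K).toAffine.Point →+ ℤ) (g : (W.baseChange K).toAffine.Point)
    (hg : crd g = 1) (hker : ∀ x, crd x = 0 → IsOfFinAddOrder x)
    (hc7 : ¬ ((7 : ℤ) ∣ D.c)) (hLLT : LiLiuTian2024.thm11_bsdp_of_cm_rank_one)
    (hKob : Kobayashi2013.cor14_bsdp_of_cm_rank_one) (hLTYZ : LiTianYanZhu2025.thm11_bsdp_of_cm_rank_one) :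
    ∀ p : ℕ, p.Prime → BSDp W p :=
  forall_bsdp_of_twist_cm7_prime (q := 11) (r := 19) (by norm_num) (by norm_num) (by norm_num)
    (by norm_num) (by norm_num) (by norm_num)
    (by rw [legendreSym_eq_ite 7 (by norm_num)]; decide)
    (by rw [legendreSym_eq_ite 11 (by norm_num)]; decide)
    (by rw [legendreSym_eq_ite 11 (by norm_num)]; decide)
    (cert_theta1_D11) (cert_theta2_D11)
    hKL hRem W hW K hK hdK D H ι ιp P hGZ hKo hGZK hmod hP hr1 hLt Wd Cd hWd hBF hu hC hBG crd g hg
    hker hc7 hLLT hKob hLTYZ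


end Summit.BirchSwinnertonDyer.Rank1Residual.X12.O11.RouteU

end
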